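import Mathlib
import Summits.Ventures.DiscreteObjects.Mahler.MahlerMeasureUnit
import Summits.Ventures.DiscreteObjects.Mahler.SmythTrinomialIrreducible
import Summits.Ventures.DiscreteObjects.Mahler.GraeffeIdentity

/-!
# Irreducible polynomials of measure `< 1.3248` are reciprocal or Smyth trinomials (venture `DiscreteObjects`, target L)

Cell `pub-namedobj`, seat `pub-namedobj-mahler` (gen 10). Framing: lottery ticket; floor = certified
bounds/negative ranges.

The census space reduction, kernel version with the exact exceptional list: an irreducible `P ∈ ℤ[X]` with
`1 < M(P) < 1.3248` is EITHER palindromic (`P.reverse = P`) of even degree `≥ 2`, OR has `M(P) = θ₀` and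
is one of the eight Smyth trinomials `±(1 - X^{2k} + aX^{3k})`, `±(1 - aX^k + aX^{3k})` (`a = ±1`,
`k ≥ 1`) — by Smyth's theorem with isolation and equality case ([McKee–Smyth, Thm 12.1], kernel gens 8–9)
and [McKee–Smyth, Ex. A.5] (`self_reciprocal_irreducible_classification`).  In particular (`< θ₀`):
every irreducible `P` with `1 < M(P) < θ₀` — e.g. every irreducible sub-Lehmer polynomial — is palindromic
of even degree, unconditionally.

* `reciprocal_or_smyth_of_measure_lt` — the dichotomy below `1.3248`;
* `reciprocal_of_measure_lt_smythTheta` — below `θ₀`: palindromic of even degree `≥ 2`.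
-/

namespace Summit.Ventures.DiscreteObjects.Mahler

open Polynomial

/-- `M(±(X - 1)) = M(±(X + 1)) = 1`. -/
theorem intMahlerMeasure_eq_one_of_linear_cyclotomic {P : ℤ[X]}
    (h : (P = X - 1 ∨ P = -(X - 1)) ∨ (P = X + 1 ∨ P = -(X + 1))) : intMahlerMeasure P = 1 := by
  have h1 : intMahlerMeasure (X - 1 : ℤ[X]) = 1 := by
    rw [← cyclotomic_one]; exact intMahlerMeasure_cyclotomic 1
  have h2 : intMahlerMeasure (X + 1 : ℤ[X]) = 1 := by
    rw [← cyclotomic_two]; exact intMahlerMeasure_cyclotomic 2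
  rcases h with (h | h) | (h | h) <;> rw [h]
  · exact h1
  · rw [intMahlerMeasure_neg]; exact h1
  · exact h2
  · rw [intMahlerMeasure_neg]; exact h2

/-- **Below `1.3248`: reciprocal or a Smyth trinomial.**  An irreducible `P ∈ ℤ[X]` with
`1 < M(P) < 1.3248` is palindromic (`P.reverse = P`) of even degree `≥ 2`, or `M(P) = θ₀` and `P` is one
of the eight Smyth trinomials of degree `3k`. -/
theorem reciprocal_or_smyth_of_measure_lt {P : ℤ[X]} (hirr : Irreducible P) (h1 : 1 < intMahlerMeasure P)
    (h2 : intMahlerMeasure P < 13248 / 10000) :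
    (P.reverse = P ∧ Even P.natDegree ∧ 2 ≤ P.natDegree) ∨
      (intMahlerMeasure P = smythTheta ∧ ∃ k : ℕ, 1 ≤ k ∧ ∃ a : ℤ, (a = 1 ∨ a = -1) ∧
        ∃ s : ℤ, (s = 1 ∨ s = -1) ∧
          (P = C s * (1 - X ^ (2 * k) + C a * X ^ (3 * k)) ∨
            P = C s * (1 - C a * X ^ k + C a * X ^ (3 * k)))) := by
  -- `P` is nonconstant with `P(0) ≠ 0`
  have hdeg : 0 < P.natDegree := by
    by_contra hd
    push Not at hd
    have hC := eq_C_of_natDegree_eq_zero (Nat.le_zero.mp hd)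
    have hM : intMahlerMeasure P = |(P.coeff 0 : ℝ)| := by rw [hC, intMahlerMeasure_C, coeff_C_zero]
    rw [hM] at h1 h2
    have h3 : (1 : ℤ) < |P.coeff 0| := by exact_mod_cast h1
    have h4 : (2 : ℝ) ≤ |(P.coeff 0 : ℝ)| := by
      have : (2 : ℤ) ≤ |P.coeff 0| := h3
      exact_mod_cast this
    linarith
  have h0 : P.coeff 0 ≠ 0 := by
    intro h
    have hX : X ∣ P := X_dvd_iff.mpr h
    have hass : Associated X P := irreducible_X.associated_of_dvd hirr hX
    obtain ⟨u, hu⟩ := hass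
    obtain ⟨c, hc, hcu⟩ := Polynomial.isUnit_iff.mp u.isUnit
    have hM : intMahlerMeasure P = 1 := by
      rw [← hu, intMahlerMeasure_mul, intMahlerMeasure_X, ← hcu, intMahlerMeasure_C]
      rcases Int.isUnit_iff.mp hc with h' | h' <;> simp [h']
    linarith
  by_cases hrec : P.reverse = P ∨ P.reverse = -P
  · -- self-reciprocal: `±(X ∓ 1)` (measure 1) or palindromic of even degree
    left
    rcases self_reciprocal_irreducible_classification hirr hrec with h | h | ⟨hrev, heven⟩
    · have := intMahlerMeasure_eq_one_of_linear_cyclotomic (Or.inl h); linarith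
    · have := intMahlerMeasure_eq_one_of_linear_cyclotomic (Or.inr h); linarith
    · refine ⟨hrev, heven, ?_⟩
      obtain ⟨j, hj⟩ := heven
      omega
  · right
    push Not at hrec
    have hMθ := intMahlerMeasure_eq_smythTheta_of_lt hirr h0 hrec.1 hrec.2 h2
    exact ⟨hMθ, (intMahlerMeasure_eq_smythTheta_iff_eq hirr h0 hrec.1 hrec.2).mp hMθ⟩

/-- **Below `θ₀`: palindromic of even degree.**  An irreducible `P ∈ ℤ[X]` with `1 < M(P) < θ₀` (in
particular every irreducible sub-Lehmer polynomial) satisfies `P.reverse = P`, `deg P` even, `deg P ≥ 2`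
— unconditionally (Smyth's theorem is in the kernel). -/
theorem reciprocal_of_measure_lt_smythTheta {P : ℤ[X]} (hirr : Irreducible P) (h1 : 1 < intMahlerMeasure P)
    (h2 : intMahlerMeasure P < smythTheta) : P.reverse = P ∧ Even P.natDegree ∧ 2 ≤ P.natDegree := by
  rcases reciprocal_or_smyth_of_measure_lt hirr h1 (lt_trans h2 smythTheta_lt) with h | ⟨hM, -⟩
  · exact h
  · rw [hM] at h2; exact absurd h2 (lt_irrefl _)

end Summit.Ventures.DiscreteObjects.Mahler
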